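import Summits.QuantumAdvantage.QuantumAdvantage.Theses.WhiteBoxWalk
import Summits.QuantumAdvantage.QuantumAdvantage.Theorems.WbwObfuscatedGluedTrees.Negative.LoadBearing

/-!
# Route `WhiteBoxWalk`, glue item `WbwWitnessGlue` (stmt-QuantumAdvantage-14785) — the abstract glue

The item `WbwWitnessGlue : WbwObfuscatedGluedTrees → WbwSuccinctWalk → WbwEngine` is INFORMAL (no
signature, no route decl) until the cruxes `W = WbwObfuscatedGluedTrees` (stmt-QuantumAdvantage-2340)
and `S = WbwSuccinctWalk` (stmt-QuantumAdvantage-2360) are typed, which in turn waits on the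
definition `obfuscatedGluedTreesGen`. What does NOT wait is the logic of the glue, which is
independent of the generator: this file proves it once and for all, PARAMETRIC in the generator
`obfGen : GenType` (`GenType`, `ClauseC`, `CruxShape` are the importable typed shapes of
`Theorems/WbwObfuscatedGluedTrees/Negative/LoadBearing.lean`), concluding the route decl
`WbwEngine := H → WbwThesis` BY NAME (stmt-QuantumAdvantage-14957; `H` = the BPR15 §5.1 premise
`∃ ε ∈ (0,1), SubexpIOExist ε ∧ TDSecurePuncturablePRFExist (2^{κ^ε}) (2^{-κ^ε}) id id ∧ ∃ f, IsOneWay f ∧ Injective f`,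
carried inline as the antecedent since route rev 5).

* `one_lt_natCeil_two_div_mul`: the BPR15 §5.1 exponent bookkeeping `1 < ⌈2/ε⌉₊ · ε` (`0 < ε`).
* `wbwEngine_of_generator` (master form): if at EVERY admissible parameter point
  `(ε, O, P, f, c)` — `ε ∈ (0,1)`, `O` a `(2^{κ^ε}, 2^{-κ^ε})`-secure iO for `P/poly`, `P` a
  LENGTH-PRESERVING `(2^{κ^ε}, 2^{-κ^ε})`-secure puncturable PRF, `f` an injective one-way function,
  `c : ℕ` with `1 < c·ε` — the pair `(gen, ans) := obfGen O P f c` is in FP, has polynomial answer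
  length, satisfies clause (Q) and clause (C), then `WbwEngine`. Proof: take `H`'s witnesses and
  `c := ⌈2/ε⌉₊`. This is the weakest pointwise form the premise `H` can feed, so every
  stronger typing of W and S (fewer antecedents) factors through it.
* `wbwEngine_of_clauses`: the same with the four obligations as four separate hypotheses (the shape
  of the informal item: structural lemmas `gen ∈ FP`, `|ans s| = p(|gen s|)` + item S + item W).
* `wbwEngine_of_cruxShape`: `W := CruxShape obfGen` verbatim (`LoadBearing.lean`; it quantifies over
  every `(t,δ)`-secure puncturable PRF, length-preserving or not, so it is STRONGER than needed) and
  the other three obligations in the pointwise form.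
* `wbwEngine_of_cruxShape_of_functionality`: the planner's "ready-made signatures" — `W := CruxShape`,
  `S :=` clause (Q) for every FUNCTIONALITY-PRESERVING obfuscator (no hardness assumption: "clause
  (Q) is WbwSuccinctWalk (functionality of O from IsSubexpIO.preserves)"), `gen ∈ FP` from the
  EFFICIENCY of `O` and `P` alone, the length lemma unconditionally.
* `wbwThesis_of_generator_of_side`, `wbwEngine_of_generator_of_side`: the same glue when W/S are typed
  over obfuscators with a SIDE CONDITION `Good O` (typing obligation T8, computable coin budget): the
  thesis from the premise strengthened by `Good`, and `WbwEngine` through the explicit w.l.o.g.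
  hypothesis "every sub-exp iO can be replaced by a `Good` one" — the one statement such a typing
  leaves open (see the section docstring).

Once `Theses.WhiteBoxWalk.WbwObfuscatedGluedTrees` / `WbwSuccinctWalk` exist with signatures of any
of these shapes, `WbwWitnessGlue` is closed by a three-line instantiation of one of the theorems here.
TYPING CAVEAT recorded for the planner (not used below): clause (Q) of `WbwThesis` demands success
`≥ 2/3` on EVERY seed `s` (not eventually in `|s|`), so S must be typed to deliver exactly that `∀ s`
clause for the generator's own `(gen, ans)`; an asymptotic or presentation-level S leaves a genuine
finite-patching step (and is unpatchable where `gen` identifies short seeds with distinct answers).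
-/

namespace Summit.QuantumAdvantage.QuantumAdvantage.Theorems.WhiteBoxWalk

open Literature.Computability.Cryptography Literature.Computability.Complexity
open Summit.QuantumAdvantage.QuantumAdvantage.Theorems.WbwObfuscatedGluedTrees.Negative
  (ClauseC GenType CruxShape)

/-- **BPR15 §5.1 exponent bookkeeping**: for `0 < ε`, the integer `c := ⌈2/ε⌉₊` satisfies
`1 < c · ε` (indeed `c · ε ≥ 2`). [cite: BitanskyPanethRosen2015, §5.1] -/
theorem one_lt_natCeil_two_div_mul {ε : ℝ} (hε : 0 < ε) : 1 < (⌈2 / ε⌉₊ : ℝ) * ε := by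
  have h1 : (2 / ε : ℝ) ≤ (⌈2 / ε⌉₊ : ℝ) := Nat.le_ceil _
  have h2 : (2 / ε) * ε = 2 := div_mul_cancel₀ 2 hε.ne'
  nlinarith

/-- **The abstract glue, master form.** Let `obfGen : GenType` be any generator (from an obfuscator
`O`, a puncturable-PRF scheme `P`, a function `f` and an exponent `c` it produces a pair
`(gen, ans)`). Suppose that at every BPR15 §5.1 parameter point — `ε ∈ (0,1)`, `O` a
`(2^{κ^ε}, 2^{-κ^ε})`-secure iO for `P/poly`, `P` a length-preserving `(2^{κ^ε}, 2^{-κ^ε})`-secure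
puncturable PRF, `f` an injective one-way function, `c : ℕ` with `1 < c·ε` — the pair
`obfGen O P f c` is polynomial-time, has polynomial answer length, and satisfies clauses (Q) and (C)
of `WbwThesis`. Then `WbwEngine : H → WbwThesis`: destructure the premise `H` into
`ε, O, P, f`, put `c := ⌈2/ε⌉₊`, and the four conjuncts of `WbwThesis` are the four conclusions at
that point. [folklore] -/
theorem wbwEngine_of_generator (obfGen : GenType)
    (h : ∀ ε : ℝ, 0 < ε → ε < 1 → ∀ O : CircuitObfuscator, IsSubexpIO ε ppolyCircuits O →
      ∀ P : PuncturablePRFScheme, P.inLen = id → P.outLen = id →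
        IsTDSecurePuncturablePRF P (fun κ => (2 : ℝ) ^ ((κ : ℝ) ^ ε))
          (fun κ => (2 : ℝ) ^ (-((κ : ℝ) ^ ε))) →
      ∀ f : List Bool → List Bool, IsOneWay f → Function.Injective f →
      ∀ c : ℕ, 1 < (c : ℝ) * ε →
        PolyTimeComputable id id (obfGen O P f c).1 ∧
        (∃ p : Polynomial ℕ, ∀ s,
          ((obfGen O P f c).2 s).length = p.eval ((obfGen O P f c).1 s).length) ∧
        (∃ F : QCircuitFamily cliffordT, F.IsOracleFree ∧ F.IsUniform ∧
          ∀ s, 2 / 3 ≤ F.kernelProb 0 ((obfGen O P f c).1 s) {y | (obfGen O P f c).2 s <+: y}) ∧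
        ClauseC (obfGen O P f c).1 (obfGen O P f c).2) :
    Theses.WhiteBoxWalk.WbwEngine := by
  unfold Theses.WhiteBoxWalk.WbwEngine
  intro hH
  obtain ⟨ε, hε, hε1, ⟨O, hO⟩, ⟨P, hPin, hPout, hP⟩, f, hf, hinj⟩ := hH
  obtain ⟨hFP, hLen, hQ, hC⟩ :=
    h ε hε hε1 O hO P hPin hPout hP f hf hinj ⌈2 / ε⌉₊ (one_lt_natCeil_two_div_mul hε)
  exact ⟨(obfGen O P f ⌈2 / ε⌉₊).1, (obfGen O P f ⌈2 / ε⌉₊).2, hFP, hLen, hQ, hC⟩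

/-- **The abstract glue, clause by clause** (the shape of the informal item `WbwWitnessGlue`):
structural lemmas of the generator (`gen ∈ FP`, `|ans s| = p(|gen s|)`), the quantum clause (Q)
(item `WbwSuccinctWalk`) and the classical clause (C) (item `WbwObfuscatedGluedTrees`), each stated
at every BPR15 §5.1 parameter point with a length-preserving PRF, imply `WbwEngine`. [folklore] -/
theorem wbwEngine_of_clauses (obfGen : GenType)
    (hFP : ∀ ε : ℝ, 0 < ε → ε < 1 → ∀ O : CircuitObfuscator, IsSubexpIO ε ppolyCircuits O →
      ∀ P : PuncturablePRFScheme, P.inLen = id → P.outLen = id →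
        IsTDSecurePuncturablePRF P (fun κ => (2 : ℝ) ^ ((κ : ℝ) ^ ε))
          (fun κ => (2 : ℝ) ^ (-((κ : ℝ) ^ ε))) →
      ∀ f : List Bool → List Bool, IsOneWay f → Function.Injective f →
      ∀ c : ℕ, 1 < (c : ℝ) * ε → PolyTimeComputable id id (obfGen O P f c).1)
    (hLen : ∀ ε : ℝ, 0 < ε → ε < 1 → ∀ O : CircuitObfuscator, IsSubexpIO ε ppolyCircuits O →
      ∀ P : PuncturablePRFScheme, P.inLen = id → P.outLen = id →
        IsTDSecurePuncturablePRF P (fun κ => (2 : ℝ) ^ ((κ : ℝ) ^ ε))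
          (fun κ => (2 : ℝ) ^ (-((κ : ℝ) ^ ε))) →
      ∀ f : List Bool → List Bool, IsOneWay f → Function.Injective f →
      ∀ c : ℕ, 1 < (c : ℝ) * ε → ∃ p : Polynomial ℕ, ∀ s,
        ((obfGen O P f c).2 s).length = p.eval ((obfGen O P f c).1 s).length)
    (hQ : ∀ ε : ℝ, 0 < ε → ε < 1 → ∀ O : CircuitObfuscator, IsSubexpIO ε ppolyCircuits O →
      ∀ P : PuncturablePRFScheme, P.inLen = id → P.outLen = id →
        IsTDSecurePuncturablePRF P (fun κ => (2 : ℝ) ^ ((κ : ℝ) ^ ε))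
          (fun κ => (2 : ℝ) ^ (-((κ : ℝ) ^ ε))) →
      ∀ f : List Bool → List Bool, IsOneWay f → Function.Injective f →
      ∀ c : ℕ, 1 < (c : ℝ) * ε → ∃ F : QCircuitFamily cliffordT, F.IsOracleFree ∧ F.IsUniform ∧
        ∀ s, 2 / 3 ≤ F.kernelProb 0 ((obfGen O P f c).1 s) {y | (obfGen O P f c).2 s <+: y})
    (hC : ∀ ε : ℝ, 0 < ε → ε < 1 → ∀ O : CircuitObfuscator, IsSubexpIO ε ppolyCircuits O →
      ∀ P : PuncturablePRFScheme, P.inLen = id → P.outLen = id →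
        IsTDSecurePuncturablePRF P (fun κ => (2 : ℝ) ^ ((κ : ℝ) ^ ε))
          (fun κ => (2 : ℝ) ^ (-((κ : ℝ) ^ ε))) →
      ∀ f : List Bool → List Bool, IsOneWay f → Function.Injective f →
      ∀ c : ℕ, 1 < (c : ℝ) * ε → ClauseC (obfGen O P f c).1 (obfGen O P f c).2) :
    Theses.WhiteBoxWalk.WbwEngine :=
  wbwEngine_of_generator obfGen fun ε hε hε1 O hO P hPin hPout hP f hf hinj c hc =>
    ⟨hFP ε hε hε1 O hO P hPin hPout hP f hf hinj c hc, hLen ε hε hε1 O hO P hPin hPout hP f hf hinj c hc,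
      hQ ε hε hε1 O hO P hPin hPout hP f hf hinj c hc, hC ε hε hε1 O hO P hPin hPout hP f hf hinj c hc⟩

/-- **The abstract glue, `CruxShape` form**: if the generator satisfies `CruxShape obfGen` (the typed
shape of `WbwObfuscatedGluedTrees` recorded in `LoadBearing.lean`: clause (C) at every BPR15 §5.1
parameter point, for ANY `(t,δ)`-secure puncturable PRF — stronger than the length-preserving case the
premise supplies), and the structural lemmas and clause (Q) hold at every parameter point, then
`WbwEngine`. [folklore] -/
theorem wbwEngine_of_cruxShape (obfGen : GenType) (hW : CruxShape obfGen)
    (hFP : ∀ ε : ℝ, 0 < ε → ε < 1 → ∀ O : CircuitObfuscator, IsSubexpIO ε ppolyCircuits O →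
      ∀ P : PuncturablePRFScheme, P.inLen = id → P.outLen = id →
        IsTDSecurePuncturablePRF P (fun κ => (2 : ℝ) ^ ((κ : ℝ) ^ ε))
          (fun κ => (2 : ℝ) ^ (-((κ : ℝ) ^ ε))) →
      ∀ f : List Bool → List Bool, IsOneWay f → Function.Injective f →
      ∀ c : ℕ, 1 < (c : ℝ) * ε → PolyTimeComputable id id (obfGen O P f c).1)
    (hLen : ∀ ε : ℝ, 0 < ε → ε < 1 → ∀ O : CircuitObfuscator, IsSubexpIO ε ppolyCircuits O →
      ∀ P : PuncturablePRFScheme, P.inLen = id → P.outLen = id →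
        IsTDSecurePuncturablePRF P (fun κ => (2 : ℝ) ^ ((κ : ℝ) ^ ε))
          (fun κ => (2 : ℝ) ^ (-((κ : ℝ) ^ ε))) →
      ∀ f : List Bool → List Bool, IsOneWay f → Function.Injective f →
      ∀ c : ℕ, 1 < (c : ℝ) * ε → ∃ p : Polynomial ℕ, ∀ s,
        ((obfGen O P f c).2 s).length = p.eval ((obfGen O P f c).1 s).length)
    (hQ : ∀ ε : ℝ, 0 < ε → ε < 1 → ∀ O : CircuitObfuscator, IsSubexpIO ε ppolyCircuits O →
      ∀ P : PuncturablePRFScheme, P.inLen = id → P.outLen = id →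
        IsTDSecurePuncturablePRF P (fun κ => (2 : ℝ) ^ ((κ : ℝ) ^ ε))
          (fun κ => (2 : ℝ) ^ (-((κ : ℝ) ^ ε))) →
      ∀ f : List Bool → List Bool, IsOneWay f → Function.Injective f →
      ∀ c : ℕ, 1 < (c : ℝ) * ε → ∃ F : QCircuitFamily cliffordT, F.IsOracleFree ∧ F.IsUniform ∧
        ∀ s, 2 / 3 ≤ F.kernelProb 0 ((obfGen O P f c).1 s) {y | (obfGen O P f c).2 s <+: y}) :
    Theses.WhiteBoxWalk.WbwEngine :=
  wbwEngine_of_clauses obfGen hFP hLen hQ fun ε hε hε1 O hO P _ _ hP f hf hinj c hc =>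
    hW ε hε hε1 O hO P hP f hf hinj c hc

/-- **The abstract glue, functionality form** (the planner's ready-made signatures for W and S):
`W := CruxShape obfGen`; `S :=` clause (Q) for the generator's pair under the sole hypothesis that the
obfuscator PRESERVES FUNCTIONALITY on `P/poly` (the quantum walk needs the obfuscated neighbour
circuit to compute the neighbour map, and nothing about hardness); `gen ∈ FP` from the EFFICIENCY of
the obfuscator and of the PRF scheme; the answer-length lemma unconditionally. The premise's
`IsSubexpIO` supplies `preserves`/`isEfficient` (`IsSecureIO`), its `IsTDSecurePuncturablePRF`
supplies `P.IsEfficient` (`IsPuncturablePRFNonuniform`). [folklore] -/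
theorem wbwEngine_of_cruxShape_of_functionality (obfGen : GenType) (hW : CruxShape obfGen)
    (hS : ∀ O : CircuitObfuscator, O.PreservesFunctionality ppolyCircuits →
      ∀ (P : PuncturablePRFScheme) (f : List Bool → List Bool) (c : ℕ),
        ∃ F : QCircuitFamily cliffordT, F.IsOracleFree ∧ F.IsUniform ∧
          ∀ s, 2 / 3 ≤ F.kernelProb 0 ((obfGen O P f c).1 s) {y | (obfGen O P f c).2 s <+: y})
    (hFP : ∀ O : CircuitObfuscator, O.IsEfficient → ∀ P : PuncturablePRFScheme, P.IsEfficient →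
      P.inLen = id → P.outLen = id → ∀ f : List Bool → List Bool, IsOneWay f →
        ∀ c : ℕ, PolyTimeComputable id id (obfGen O P f c).1)
    (hLen : ∀ (O : CircuitObfuscator) (P : PuncturablePRFScheme) (f : List Bool → List Bool) (c : ℕ),
      ∃ p : Polynomial ℕ, ∀ s,
        ((obfGen O P f c).2 s).length = p.eval ((obfGen O P f c).1 s).length) :
    Theses.WhiteBoxWalk.WbwEngine :=
  wbwEngine_of_cruxShape obfGen hW
    (fun _ _ _ O hO P hPin hPout hP f hf _ c _ =>
      hFP O hO.isEfficient P hP.isPuncturablePRFNonuniform.1 hPin hPout f hf c)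
    (fun _ _ _ O _ P _ _ _ f _ _ c _ => hLen O P f c)
    (fun _ _ _ O hO P _ _ _ f _ _ c _ => hS O hO.preserves P f c)

/-! ## The same glue with a SIDE CONDITION on the obfuscator (typing obligation T8: computable coins)

The refuters' typing obligation T8 (`Cruxes/WbwObfuscatedGluedTrees/Disproof.lean`, cycle 4;
`NegativeNotes-T8-computable-coins.md`): `gen ∈ FP` for the intended generator needs the obfuscator's
coin budget `O.coinLen` to be COMPUTABLE (under `O.IsEfficient` it is only polynomially bounded), so
the typed W, S and structural lemmas may quantify over sub-exponentially secure iO WITH a side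
condition `Good O` (e.g. `∃ q : Polynomial ℕ, O.coinLen = fun ℓ => q.eval ℓ`). The two theorems below
isolate what the glue then needs: `WbwThesis` follows from the premise STRENGTHENED by `Good`
(`wbwThesis_of_generator_of_side`), and the route decl `WbwEngine` (premise `H` as typed in rev 5,
plain `SubexpIOExist ε`) follows only through the explicit w.l.o.g. hypothesis
`hwlog : IsSubexpIO ε ppolyCircuits O → ∃ O', IsSubexpIO ε ppolyCircuits O' ∧ Good O'`
(`wbwEngine_of_generator_of_side`) — for `Good :=` "computable coins" that w.l.o.g. is NOT known to be
derivable in the tree's model (off-budget coin strings of `O.obf` are unconstrained), so with a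
T8-typed W the planner must either strengthen `H` by the side condition or supply
`hwlog`. With `Good := fun _ => True` both reduce to `wbwEngine_of_generator`. -/

/-- **Glue to the thesis under a side condition on the obfuscator.** For any predicate `Good` on
obfuscators and any generator: if the four obligations (FP, answer length, (Q), (C)) hold at every
BPR15 §5.1 parameter point whose obfuscator moreover satisfies `Good`, then the premise strengthened by
`Good` — `∃ ε ∈ (0,1), (∃ O, IsSubexpIO ε ppolyCircuits O ∧ Good O) ∧ (length-preserving
(2^{κ^ε},2^{-κ^ε})-secure puncturable PRF) ∧ (injective OWF)` — implies `WbwThesis`. [folklore] -/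
theorem wbwThesis_of_generator_of_side (Good : CircuitObfuscator → Prop) (obfGen : GenType)
    (h : ∀ ε : ℝ, 0 < ε → ε < 1 → ∀ O : CircuitObfuscator, IsSubexpIO ε ppolyCircuits O → Good O →
      ∀ P : PuncturablePRFScheme, P.inLen = id → P.outLen = id →
        IsTDSecurePuncturablePRF P (fun κ => (2 : ℝ) ^ ((κ : ℝ) ^ ε))
          (fun κ => (2 : ℝ) ^ (-((κ : ℝ) ^ ε))) →
      ∀ f : List Bool → List Bool, IsOneWay f → Function.Injective f →
      ∀ c : ℕ, 1 < (c : ℝ) * ε →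
        PolyTimeComputable id id (obfGen O P f c).1 ∧
        (∃ p : Polynomial ℕ, ∀ s,
          ((obfGen O P f c).2 s).length = p.eval ((obfGen O P f c).1 s).length) ∧
        (∃ F : QCircuitFamily cliffordT, F.IsOracleFree ∧ F.IsUniform ∧
          ∀ s, 2 / 3 ≤ F.kernelProb 0 ((obfGen O P f c).1 s) {y | (obfGen O P f c).2 s <+: y}) ∧
        ClauseC (obfGen O P f c).1 (obfGen O P f c).2)
    (hH : ∃ ε : ℝ, 0 < ε ∧ ε < 1 ∧ (∃ O : CircuitObfuscator, IsSubexpIO ε ppolyCircuits O ∧ Good O) ∧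
      TDSecurePuncturablePRFExist (fun κ => (2 : ℝ) ^ ((κ : ℝ) ^ ε))
        (fun κ => (2 : ℝ) ^ (-((κ : ℝ) ^ ε))) id id ∧
      ∃ f : List Bool → List Bool, IsOneWay f ∧ Function.Injective f) :
    Theses.WhiteBoxWalk.WbwThesis := by
  obtain ⟨ε, hε, hε1, ⟨O, hO, hG⟩, ⟨P, hPin, hPout, hP⟩, f, hf, hinj⟩ := hH
  obtain ⟨hFP, hLen, hQ, hC⟩ :=
    h ε hε hε1 O hO hG P hPin hPout hP f hf hinj ⌈2 / ε⌉₊ (one_lt_natCeil_two_div_mul hε)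
  exact ⟨(obfGen O P f ⌈2 / ε⌉₊).1, (obfGen O P f ⌈2 / ε⌉₊).2, hFP, hLen, hQ, hC⟩

/-- **Glue to `WbwEngine` under a side condition, through an explicit w.l.o.g. hypothesis.** With
W, S and the structural lemmas typed over obfuscators satisfying `Good`, the route decl
`WbwEngine : H → WbwThesis` follows as soon as every sub-exponentially secure iO for
`P/poly` can be replaced by one satisfying `Good` at the same exponent (`hwlog`). This names exactly
the statement a T8-typed W leaves to discharge; for `Good := fun _ => True` it is trivial. [folklore] -/
theorem wbwEngine_of_generator_of_side (Good : CircuitObfuscator → Prop) (obfGen : GenType)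
    (h : ∀ ε : ℝ, 0 < ε → ε < 1 → ∀ O : CircuitObfuscator, IsSubexpIO ε ppolyCircuits O → Good O →
      ∀ P : PuncturablePRFScheme, P.inLen = id → P.outLen = id →
        IsTDSecurePuncturablePRF P (fun κ => (2 : ℝ) ^ ((κ : ℝ) ^ ε))
          (fun κ => (2 : ℝ) ^ (-((κ : ℝ) ^ ε))) →
      ∀ f : List Bool → List Bool, IsOneWay f → Function.Injective f →
      ∀ c : ℕ, 1 < (c : ℝ) * ε →
        PolyTimeComputable id id (obfGen O P f c).1 ∧
        (∃ p : Polynomial ℕ, ∀ s,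
          ((obfGen O P f c).2 s).length = p.eval ((obfGen O P f c).1 s).length) ∧
        (∃ F : QCircuitFamily cliffordT, F.IsOracleFree ∧ F.IsUniform ∧
          ∀ s, 2 / 3 ≤ F.kernelProb 0 ((obfGen O P f c).1 s) {y | (obfGen O P f c).2 s <+: y}) ∧
        ClauseC (obfGen O P f c).1 (obfGen O P f c).2)
    (hwlog : ∀ ε : ℝ, 0 < ε → ε < 1 → ∀ O : CircuitObfuscator, IsSubexpIO ε ppolyCircuits O →
      ∃ O' : CircuitObfuscator, IsSubexpIO ε ppolyCircuits O' ∧ Good O') :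
    Theses.WhiteBoxWalk.WbwEngine := by
  unfold Theses.WhiteBoxWalk.WbwEngine
  rintro ⟨ε, hε, hε1, ⟨O, hO⟩, hPRF, hOWF⟩
  obtain ⟨O', hO', hG⟩ := hwlog ε hε hε1 O hO
  exact wbwThesis_of_generator_of_side Good obfGen h ⟨ε, hε, hε1, ⟨O', hO', hG⟩, hPRF, hOWF⟩

end Summit.QuantumAdvantage.QuantumAdvantage.Theorems.WhiteBoxWalk
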